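import Summits.QuantumFields.BalabanUV.T4Continuum.Spine.NE9.DirectPairingPropagationCarriers

/-!
# T⁴ programme, spine estimate NE9 — KING'S CURRENCY, WHERE THE UNIFORMITY COMES FROM: over the DOMAINS and RUNS of a fixed scale the
# separate-uniform-continuity input of `TowerCarriersKing` is FREE — up to a loss `κ' < κ` in the decay weight — from (i) a finite list
# of SHAPES below every tree length, (ii) the (1.18)-type bound at `κ`, and (iii) per SHAPE: the normalised term FACTORS through a
# COMPACT space of local data on which it is JOINTLY CONTINUOUS together with its young couplings on the CLOSED coupling cube
# (Heine–Cantor); across the levels at fixed age tower-NE5 pays as before — census item C34 of cell `pub-balaban-gaps`, seat ne9 (gen 7)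

Cell `pub-balaban-gaps` (YM blitz G2, seat ne9, unit `pub-balaban-gaps-ne9-g7`; record `run/shared/lean/pub/pub-balaban-gaps/ne/NE9.md` §5
row C34).  Summits-side bookkeeping; real analysis on hypothesis SHAPES over gen 4's `TowerCarriers.TowerData`; no definition; nothing of
Bałaban's asserted.

WHY.  Gens 6–7 reduced the E-side input of NE9-as-consumed, in King's (direct-pairing) organisation of node U6, to the carriers-level
hypothesis `hUC` of `TowerCarriersKing.directBracket_eventually_le_carriers`: per scale `m` and young coupling `i < m`, ONE modulus of
continuity serving EVERY run `k`, background `U` and domain `X` of scale `m` (`r X + m = k`) — and showed (C33) that it is inherited from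
two qualitative clauses about ONE renormalization step whose only non-printed part is exactly this UNIFORMITY over runs ∕ backgrounds ∕
domains, load-bearing on non-compact parameter ranges (`DirectPairingPropagation.crossTower_not_sepUC`) and free on compact ones
(`sepUC_hyps_of_compact`, `DirectPairingPropagationCarriers.uniformLast_of_net`).  This file locates the compactness in the STRUCTURE of
Bałaban's localized representation, abstractly: (L) LOCALITY — the scale-`m` term at `X` depends on the background through LOCAL DATA on a
neighbourhood of `X` ([Balaban1988RG2Cluster] (1.34) p. 9: *"it depends on configurations U, J, B restricted to the interior of Y"*;
[Balaban1987RG1] (1.7)∕(1.9) p. 261), which for a FIXED SHAPE range over a COMPACT space (a power of the compact gauge group over the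
finitely many bonds of the neighbourhood — READING; for the finitely many runs whose torus is smaller than the neighbourhood, a finite
union of such — READING); (S) finitely many SHAPES below every tree length (lattice animals up to the printed Euclidean covariance, [I]
p. 263 — READING); (B) the (1.18) bound `e^{κd(X)}|E| ≤ B`; (K) a LOSS `κ' < κ` in the decay weight handed to nodes U5∕U6 — print's own
habit ([II] (1.36) p. 9: `exp(−(1−2δ)κ d_k(Y))`).  Then:
* §1 `towerNE5On_mono_kappa`, `bound_mono_kappa` — the tower rate and the bound survive the loss `κ ↦ κ'`.
* §2 **`sepUC_of_shapes`** — (S) + (B) + (K) + per-SHAPE uniform moduli at `κ` ⇒ the carriers-level `hUC` at `κ'` for ALL domains of the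
  scale: LARGE shapes (`d > D(ε)`) need no continuity at all (`2B·e^{−(κ−κ')D} ≤ ε`), the finitely many SMALL shapes share a finite minimum
  of moduli (`DirectPairingPropagationCarriers.exists_common_delta`).
* §3 **`sepUCshape_of_compact`** — per shape and scale: (L) factorisation of the normalised term through a compact set `Kc` of local data +
  JOINT CONTINUITY of `(young couplings, local datum) ↦ e^{κd}·E` on `[a, b]^m × Kc` ⇒ the per-shape uniform modulus on every sub-box
  `BoxWindow J`, `J ⊆ [a, b]` (Heine–Cantor on the compact product; print's coupling interval IS closed, [I] p. 263 *"g_{j−1} ∈ [0, γ]"*).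
* §4 **`directBracket_eventually_le_carriers_of_shapes`**, **`king_U6_of_shapes`** — the King-currency ENDs BY NAME at the weight `κ'`:
  `TowerNE5On` at `κ` + prefix dependence + per-shape moduli at `κ` + (S) + (B) + (K) (+ node U2's summable consecutive profile) ⇒ the direct
  bracket of the runs `k`, `k + n` is eventually `≤ η·e^{−κ'd(X)}` at EVERY domain, uniformly in `n`; scale profile `b_j → 0`; `delta → 0`.

VERDICT FOR THE ROW (bookkeeping).  In King's currency, GIVEN tower-NE5 and a κ-loss, the E-side input of NE9-as-consumed carries NO
UNIFORMITY CLAUSE over domains or backgrounds: it is «per scale and SHAPE, the normalised local term is a JOINTLY CONTINUOUS function of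
its young couplings on the closed cube and of its local background datum on a compact space» + the STRUCTURE (L)(S)(B) of the localized
representation — continuity + compactness + locality + tower-NE5, no modulus, no constant, nothing about the coupling history beyond
continuity.  What remains of printed KIND but unprinted LETTER is only the uniformity over the RUNS at a fixed shape where locality does
not already make the term run-independent (READING above).  Classification of NE9 UNCHANGED in kind (WORK-bound on W1: the local terms,
their localized representation and their continuity ARE properties of the one-step object; instance 0∕1).

HONEST FRAMING: bookkeeping for rung (B)+1 on ONE FIXED finite four-torus; (L)(S) are modelled by abstract data (`sh`, `dS`, `loc`, `Kc`),
not constructed for Bałaban's domains; tower-NE5 is the cell's estimate NE5 (NOT PRINTED, NOT PROVED); NE9 NOT PRINTED ∕ NOT PROVED; spine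
PROVED 0∕9 unchanged; NOT UV stability, NOT the continuum limit, NOT infinite volume, NOT a mass gap, NOT Clay.

References (TYPES only): [Balaban1987RG1] = T. Bałaban, Commun. Math. Phys. **109** (1987) 249–301, (1.7)∕(1.9) p. 261, p. 263, (1.18)
p. 263; [Balaban1988RG2Cluster] = T. Bałaban, Commun. Math. Phys. **116** (1988) 1–22, (1.34)∕(1.36) p. 9; [King1986] = C. King, Commun.
Math. Phys. **102** (1986) 649–677, §3.2 pp. 656–657.
-/

namespace Summit.QuantumFields.BalabanUV.T4Continuum.NE9.DirectPairingLocality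

open scoped BigOperators
open Finset Filter Topology Metric Set
open Literature.MathematicalPhysics.QuantumFieldTheory.Balaban1983to89
open Literature.MathematicalPhysics.QuantumFieldTheory.Balaban1983to89.T4OutputRate (NE5)
open Literature.MathematicalPhysics.QuantumFieldTheory.Balaban1983to89.T4CouplingAnalyticity (BoxWindow)
open T4CauchySum (delta)
open Summit.QuantumFields.BalabanUV.T4Continuum.NE9.TowerCarriers
open Summit.QuantumFields.BalabanUV.T4Continuum.NE9.TowerCarriersBox (TowerNE5On)
open Summit.QuantumFields.BalabanUV.T4Continuum.NE9.TowerCarriersKing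
  (directBracket_eventually_le_carriers king_U6_of_carriers)
open Summit.QuantumFields.BalabanUV.T4Continuum.NE9.DirectPairingPropagationCarriers (exists_common_delta)

variable (T : TowerData) {E : ℕ → (ℕ → ℝ) → T.B → T.Dom → ℝ} {I : Set ℝ} {κ κ' : ℝ}

/-! ## §1 The loss `κ ↦ κ'` costs nothing upstream -/

/-- Tower-NE5 at the weight `κ` implies tower-NE5 at any smaller weight `κ' ≤ κ` (`C₅, θ ≥ 0`; tree lengths are nonnegative). [folklore] -/
theorem towerNE5On_mono_kappa {θ C₅ : ℝ} (hC : 0 ≤ C₅) (hθ : 0 ≤ θ) (hκ : κ' ≤ κ)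
    (h5 : TowerNE5On T E I κ θ C₅) : TowerNE5On T E I κ' θ C₅ := by
  intro k b hb g hg U X
  refine (h5 k b hb g hg U X).trans (mul_le_mul_of_nonneg_left (Real.exp_le_exp.2 ?_) (by positivity))
  have hd : 0 ≤ (T.level k).d X := (T.level k).d_nonneg X
  nlinarith

/-- The normalised bound at `κ` implies the one at `κ' ≤ κ`. [folklore] -/
theorem bound_mono_kappa {B : ℝ} (hκ : κ' ≤ κ)
    (hB : ∀ (k : ℕ) (U : T.B) (X : T.Dom), ∀ g ∈ BoxWindow I, Real.exp (κ * T.d X) * |E k g U X| ≤ B) :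
    ∀ (k : ℕ) (U : T.B) (X : T.Dom), ∀ g ∈ BoxWindow I, Real.exp (κ' * T.d X) * |E k g U X| ≤ B := fun k U X g hg =>
  (mul_le_mul_of_nonneg_right (Real.exp_le_exp.2 (mul_le_mul_of_nonneg_right hκ (T.d_nonneg X))) (abs_nonneg _)).trans
    (hB k U X g hg)

/-! ## §2 Finitely many small shapes + the bound + a κ-loss: uniformity over ALL domains of a scale from per-shape uniformity -/

/-- **UNIFORMITY OVER THE DOMAINS OF A SCALE, UP TO A κ-LOSS.**  Shapes `sh : Dom → Sh` with the tree length a function of the shape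
(`hd`), finitely many shapes below every length (`hfin`), the normalised bound `e^{κd}|E| ≤ B` (`hB`), a loss `κ' < κ`, and PER SHAPE a
separate-uniform-continuity modulus at the weight `κ` serving every run ∕ background ∕ domain of that shape and scale (`hUCσ`) ⇒ the
carriers-level hypothesis `hUC` of `TowerCarriersKing.directBracket_eventually_le_carriers` at the weight `κ'`, for ALL domains of the scale:
shapes longer than `D` with `2B·e^{−(κ−κ')D} ≤ ε` need nothing; the finitely many shorter ones share a finite minimum of moduli. [folklore] -/
theorem sepUC_of_shapes {Sh : Type*} (sh : T.Dom → Sh) (dS : Sh → ℝ) (hd : ∀ X, T.d X = dS (sh X))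
    (hfin : ∀ D : ℝ, {σ | dS σ ≤ D}.Finite) {B : ℝ}
    (hB : ∀ (k : ℕ) (U : T.B) (X : T.Dom), ∀ g ∈ BoxWindow I, Real.exp (κ * T.d X) * |E k g U X| ≤ B) (hκ : κ' < κ)
    (hUCσ : ∀ (σ : Sh) (m i : ℕ), i < m → ∀ ε : ℝ, 0 < ε → ∃ δ : ℝ, 0 < δ ∧ ∀ (k : ℕ) (U : T.B) (X : T.Dom), sh X = σ →
      T.r X + m = k → ∀ g ∈ BoxWindow I, ∀ g' ∈ BoxWindow I, (∀ j, j ≠ i → g j = g' j) → |g i - g' i| ≤ δ →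
        Real.exp (κ * T.d X) * |E k g U X - E k g' U X| ≤ ε) :
    ∀ m i : ℕ, i < m → ∀ ε : ℝ, 0 < ε → ∃ δ : ℝ, 0 < δ ∧ ∀ (k : ℕ) (U : T.B) (X : T.Dom), T.r X + m = k →
      ∀ g ∈ BoxWindow I, ∀ g' ∈ BoxWindow I, (∀ j, j ≠ i → g j = g' j) → |g i - g' i| ≤ δ →
        Real.exp (κ' * T.d X) * |E k g U X - E k g' U X| ≤ ε := by
  intro m i hi ε hε
  set c : ℝ := κ - κ' with hc
  have hc0 : 0 < c := sub_pos.2 hκ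
  set τ : ℝ := ε / (2 * |B| + 1) with hτ
  have hτ0 : 0 < τ := by positivity
  -- a length threshold `D ≥ 0` with `e^{−cD} ≤ τ`
  set D : ℝ := max 0 (-Real.log τ / c) with hD
  have hDτ : Real.exp (-(c * D)) ≤ τ := by
    have h1 : -Real.log τ / c ≤ D := le_max_right _ _
    have h2 : -(c * D) ≤ Real.log τ := by
      have h3 := mul_le_mul_of_nonneg_left h1 hc0.le
      rw [mul_div_cancel₀ _ hc0.ne'] at h3
      linarith
    calc Real.exp (-(c * D)) ≤ Real.exp (Real.log τ) := Real.exp_le_exp.2 h2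
      _ = τ := Real.exp_log hτ0
  -- the finitely many short shapes share one modulus (at the weight κ)
  obtain ⟨δ, hδ, hF⟩ := exists_common_delta (hfin D).toFinset
    (fun σ δ => ∀ (k : ℕ) (U : T.B) (X : T.Dom), sh X = σ → T.r X + m = k → ∀ g ∈ BoxWindow I, ∀ g' ∈ BoxWindow I,
      (∀ j, j ≠ i → g j = g' j) → |g i - g' i| ≤ δ → Real.exp (κ * T.d X) * |E k g U X - E k g' U X| ≤ ε)
    (fun σ δ δ' hle h k U X hX hk g hg g' hg' ha hdd => h k U X hX hk g hg g' hg' ha (hdd.trans hle))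
    (fun σ _ => hUCσ σ m i hi ε hε)
  refine ⟨δ, hδ, fun k U X hk g hg g' hg' hagree hdiff => ?_⟩
  have hdX : 0 ≤ T.d X := T.d_nonneg X
  by_cases hs : dS (sh X) ≤ D
  · -- a short shape: the common modulus at `κ`, then `κ' ≤ κ`
    have h := hF (sh X) ((hfin D).mem_toFinset.2 hs) k U X rfl hk g hg g' hg' hagree hdiff
    exact (mul_le_mul_of_nonneg_right (Real.exp_le_exp.2 (mul_le_mul_of_nonneg_right hκ.le hdX)) (abs_nonneg _)).trans h
  · -- a long shape: the bound alone
    have hdD : D < T.d X := by rw [hd]; exact lt_of_not_ge hs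
    have hcd : Real.exp (-(c * T.d X)) ≤ τ := (Real.exp_le_exp.2 (by nlinarith)).trans hDτ
    have h1 := hB k U X g hg
    have h2 := hB k U X g' hg'
    have hpos : 0 < Real.exp (κ * T.d X) := Real.exp_pos _
    have hexp : Real.exp (κ' * T.d X) = Real.exp (-(c * T.d X)) * Real.exp (κ * T.d X) := by
      rw [← Real.exp_add, hc]; congr 1; ring
    have hBabs : B ≤ |B| := le_abs_self B
    calc Real.exp (κ' * T.d X) * |E k g U X - E k g' U X|
        = Real.exp (-(c * T.d X)) * (Real.exp (κ * T.d X) * |E k g U X - E k g' U X|) := by rw [hexp, mul_assoc]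
      _ ≤ Real.exp (-(c * T.d X)) * (Real.exp (κ * T.d X) * (|E k g U X| + |E k g' U X|)) :=
          mul_le_mul_of_nonneg_left (mul_le_mul_of_nonneg_left (abs_sub _ _) hpos.le) (Real.exp_pos _).le
      _ ≤ τ * (2 * |B|) := by
          refine mul_le_mul hcd ?_ (by positivity) hτ0.le
          rw [mul_add]; linarith
      _ ≤ ε := by
          rw [hτ, div_mul_eq_mul_div, div_le_iff₀ (by positivity)]
          nlinarith [abs_nonneg B]

/-! ## §3 Per shape: factorisation through COMPACT local data + JOINT CONTINUITY on the closed cube ⇒ the uniform modulus (Heine–Cantor) -/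

/-- **THE PER-SHAPE MODULUS FROM LOCALITY + COMPACTNESS + JOINT CONTINUITY.**  Fix a shape `σ` and a scale `m`.  If for every run `k`,
background `U` and domain `X` of that shape and scale the normalised term FACTORS as `e^{κd(X)}·E k g U X = Em (g|_{<m}) (loc k U X)` through a
local datum `loc k U X` in a COMPACT set `Kc` (locality of the localized representation: [Balaban1988RG2Cluster] (1.34) p. 9; a power of the
compact gauge group over the finitely many bonds near a domain of shape `σ` — READING), with `Em` JOINTLY CONTINUOUS on the compact
`[a, b]^m × Kc` (young couplings on the CLOSED cube: [Balaban1987RG1] p. 263 *"g_{j−1} ∈ [0, γ]"*), then ONE `δ` serves every run, background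
and domain of shape `σ` and scale `m` on every sub-box `BoxWindow J`, `J ⊆ [a, b]`: exactly the per-shape hypothesis `hUCσ` of `sepUC_of_shapes`.
No uniformity is assumed; it is produced by Heine–Cantor on the compact product. [folklore] -/
theorem sepUCshape_of_compact {Sh : Type*} (sh : T.Dom → Sh) (σ : Sh) (m : ℕ) {L : Type*} [PseudoMetricSpace L]
    {Kc : Set L} (hKc : IsCompact Kc) {a b : ℝ} {J : Set ℝ} (hJ : J ⊆ Icc a b) (Em : (Fin m → ℝ) → L → ℝ)
    (hcont : ContinuousOn (fun p : (Fin m → ℝ) × L => Em p.1 p.2) ((Set.univ.pi fun _ => Icc a b) ×ˢ Kc))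
    (loc : ℕ → T.B → T.Dom → L)
    (hfac : ∀ (k : ℕ) (U : T.B) (X : T.Dom), sh X = σ → T.r X + m = k → loc k U X ∈ Kc ∧
      ∀ g ∈ BoxWindow J, Real.exp (κ * T.d X) * E k g U X = Em (fun l => g l) (loc k U X)) :
    ∀ (i : ℕ) (ε : ℝ), 0 < ε → ∃ δ : ℝ, 0 < δ ∧ ∀ (k : ℕ) (U : T.B) (X : T.Dom), sh X = σ → T.r X + m = k →
      ∀ g ∈ BoxWindow J, ∀ g' ∈ BoxWindow J, (∀ j, j ≠ i → g j = g' j) → |g i - g' i| ≤ δ →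
        Real.exp (κ * T.d X) * |E k g U X - E k g' U X| ≤ ε := by
  intro i ε hε
  have hC : IsCompact ((Set.univ.pi fun _ : Fin m => Icc a b) ×ˢ Kc) :=
    (isCompact_univ_pi fun _ => isCompact_Icc).prod hKc
  obtain ⟨δ, hδ, h⟩ := Metric.uniformContinuousOn_iff_le.1 (hC.uniformContinuousOn_of_continuous hcont) ε hε
  refine ⟨δ, hδ, fun k U X hX hk g hg g' hg' hagree hdiff => ?_⟩
  obtain ⟨hloc, hE⟩ := hfac k U X hX hk
  have hcube : ∀ h : ℕ → ℝ, h ∈ BoxWindow J → (fun l : Fin m => h l) ∈ Set.univ.pi fun _ : Fin m => Icc a b :=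
    fun h hh l _ => hJ (hh l)
  have hmem : ((fun l : Fin m => g l), loc k U X) ∈ (Set.univ.pi fun _ : Fin m => Icc a b) ×ˢ Kc := ⟨hcube g hg, hloc⟩
  have hmem' : ((fun l : Fin m => g' l), loc k U X) ∈ (Set.univ.pi fun _ : Fin m => Icc a b) ×ˢ Kc := ⟨hcube g' hg', hloc⟩
  have hdist : dist ((fun l : Fin m => g l), loc k U X) ((fun l : Fin m => g' l), loc k U X) ≤ δ := by
    rw [Prod.dist_eq, dist_self]
    refine max_le ((dist_pi_le_iff hδ.le).2 fun l => ?_) hδ.le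
    show dist (g l) (g' l) ≤ δ
    by_cases hl : (l : ℕ) = i
    · rw [Real.dist_eq, hl]; exact hdiff
    · rw [hagree l hl, dist_self]; exact hδ.le
  have key := h _ hmem _ hmem' hdist
  dsimp only at key
  rw [Real.dist_eq, ← hE g hg, ← hE g' hg', ← mul_sub, abs_mul, abs_of_pos (Real.exp_pos _)] at key
  exact key

/-! ## §4 The King-currency ENDs at the weight `κ'`, BY NAME -/

/-- **KING'S CURRENCY ON THE CARRIERS FROM PER-SHAPE MODULI** (`TowerCarriersKing.directBracket_eventually_le_carriers` BY NAME at `κ'`):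
tower-NE5 at `κ` + prefix dependence + per-shape moduli at `κ` + finitely many short shapes + the bound + `κ' < κ` + a profile `P_i → 0` ⇒ ONE
scale threshold beyond which every direct bracket of the runs `k`, `k + n` at every background and EVERY domain is `≤ η·e^{−κ'd(X)}`,
uniformly in `n`. [folklore] -/
theorem directBracket_eventually_le_carriers_of_shapes {θ C₅ B : ℝ} {P : ℕ → ℝ} {Sh : Type*} (sh : T.Dom → Sh) (dS : Sh → ℝ)
    (hd : ∀ X, T.d X = dS (sh X)) (hfin : ∀ D : ℝ, {σ | dS σ ≤ D}.Finite)
    (hC : 0 ≤ C₅) (hθ0 : 0 ≤ θ) (hθ1 : θ < 1) (hκ : κ' < κ) (h5 : TowerNE5On T E I κ θ C₅)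
    (hP : ∀ (k : ℕ) (U : T.B) (X : T.Dom), ∀ g ∈ BoxWindow I, ∀ g' ∈ BoxWindow I,
      (∀ i, i < k - T.r X → g i = g' i) → E k g U X = E k g' U X)
    (hB : ∀ (k : ℕ) (U : T.B) (X : T.Dom), ∀ g ∈ BoxWindow I, Real.exp (κ * T.d X) * |E k g U X| ≤ B)
    (hUCσ : ∀ (σ : Sh) (m i : ℕ), i < m → ∀ ε : ℝ, 0 < ε → ∃ δ : ℝ, 0 < δ ∧ ∀ (k : ℕ) (U : T.B) (X : T.Dom), sh X = σ →
      T.r X + m = k → ∀ g ∈ BoxWindow I, ∀ g' ∈ BoxWindow I, (∀ j, j ≠ i → g j = g' j) → |g i - g' i| ≤ δ →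
        Real.exp (κ * T.d X) * |E k g U X - E k g' U X| ≤ ε)
    (hPt : Tendsto P atTop (𝓝 0)) {η : ℝ} (hη : 0 < η) :
    ∃ M₀ : ℕ, ∀ (k n : ℕ) (U : T.B) (X : T.Dom), T.r X + M₀ ≤ k →
      ∀ g ∈ BoxWindow I, ∀ g' ∈ BoxWindow I, (∀ i, i < k - T.r X → |g (i + n) - g' i| ≤ P i) →
        |E (k + n) g U X - E k g' (T.descend (k + n) U k) X| ≤ η * Real.exp (-(κ' * T.d X)) :=
  directBracket_eventually_le_carriers T hC hθ0 hθ1 (towerNE5On_mono_kappa T hC hθ0 hκ.le h5) hP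
    (sepUC_of_shapes T sh dS hd hfin hB hκ hUCσ) hPt hη

/-- **NODE U6 IN KING'S CURRENCY FROM PER-SHAPE MODULI** (`TowerCarriersKing.king_U6_of_carriers` BY NAME at `κ'`): add `B ≥ 0` and node U2's
nonnegative summable K-uniform consecutive matching profile along the run histories ⇒ a scale profile `b_j → 0` dominating the direct bracket
of the runs `K`, `K + n` at every background and domain in the weight `e^{−κ'd}`, and `T4CauchySum.delta E₀ ρ inj K → 0` for every injection
under it.  E-side inputs: tower-NE5, per-shape joint-continuity moduli (§3), (S), (B), (K) — no uniformity clause over domains. [folklore] -/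
theorem king_U6_of_shapes {θ C₅ B : ℝ} {p : ℕ → ℝ} {t : ℕ → ℕ → ℝ} {Sh : Type*} (sh : T.Dom → Sh) (dS : Sh → ℝ)
    (hd : ∀ X, T.d X = dS (sh X)) (hfin : ∀ D : ℝ, {σ | dS σ ≤ D}.Finite)
    (hC : 0 ≤ C₅) (hθ0 : 0 ≤ θ) (hθ1 : θ < 1) (hκ : κ' < κ) (h5 : TowerNE5On T E I κ θ C₅)
    (hP : ∀ (k : ℕ) (U : T.B) (X : T.Dom), ∀ g ∈ BoxWindow I, ∀ g' ∈ BoxWindow I,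
      (∀ i, i < k - T.r X → g i = g' i) → E k g U X = E k g' U X)
    (hB0 : 0 ≤ B) (hB : ∀ (k : ℕ) (U : T.B) (X : T.Dom), ∀ g ∈ BoxWindow I, Real.exp (κ * T.d X) * |E k g U X| ≤ B)
    (hUCσ : ∀ (σ : Sh) (m i : ℕ), i < m → ∀ ε : ℝ, 0 < ε → ∃ δ : ℝ, 0 < δ ∧ ∀ (k : ℕ) (U : T.B) (X : T.Dom), sh X = σ →
      T.r X + m = k → ∀ g ∈ BoxWindow I, ∀ g' ∈ BoxWindow I, (∀ j, j ≠ i → g j = g' j) → |g i - g' i| ≤ δ →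
        Real.exp (κ * T.d X) * |E k g U X - E k g' U X| ≤ ε)
    (ht : ∀ K, t K ∈ BoxWindow I) (hp : ∀ K i, |t (K + 1) (i + 1) - t K i| ≤ p i) (hp0 : ∀ i, 0 ≤ p i) (hps : Summable p) :
    ∃ b : ℕ → ℝ, (∀ j, 0 ≤ b j) ∧ Tendsto b atTop (𝓝 0) ∧
      (∀ (K n : ℕ) (U : T.B) (X : T.Dom), T.r X ≤ K →
        |E (K + n) (t (K + n)) U X - E K (t K) (T.descend (K + n) U K) X| ≤ b (K - T.r X) * Real.exp (-(κ' * T.d X))) ∧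
      ∀ (E₀ ρ : ℝ) (inj : ℕ → ℕ → ℝ), 0 ≤ E₀ → 0 ≤ ρ → ρ < 1 →
        (∀ K j : ℕ, j ≤ K → 0 ≤ inj K j ∧ inj K j ≤ b j) → Tendsto (delta E₀ ρ inj) atTop (𝓝 0) :=
  king_U6_of_carriers T hC hθ0 hθ1 (towerNE5On_mono_kappa T hC hθ0 hκ.le h5) hP
    (sepUC_of_shapes T sh dS hd hfin hB hκ hUCσ) hB0 (bound_mono_kappa T hκ.le hB) ht hp hp0 hps

/-! ## §5 (appended 2026-08-23, same seat) The κ-loss is NECESSARY in this generality: a tower of shapes with per-shape moduli and the bound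
at `κ`, whose moduli degrade with the shape so that NO modulus serves all domains at the weight `κ` — while `sepUC_of_shapes` serves them at
every `κ' < κ`.  (For Bałaban's terms a shape-uniform derivative bound in the couplings — printed for `β` only, [I] p. 264 — would remove the
loss; with continuity + (1.18) alone it cannot be removed.) -/

/-- WITNESS DATA: domains = shapes = `ℕ`, tree length `d n = n`, every domain born in run `0`, one background. [folklore] -/
def shapeTower : TowerData where
  Dom := ℕ
  r := fun _ => 0
  d := fun n => n
  d_nonneg := fun n => Nat.cast_nonneg n
  B := Unit
  gauge := fun _ _ => 0
  gauge_nonneg := fun _ _ => le_rfl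
  tr := fun _ U => U

/-- WITNESS TERMS at weight `κ`: `E k g U n = e^{−κn}·sin((n+1)·g₀)` — bounded by `e^{−κ d}`, `(n+1)`-Lipschitz in `g₀` after normalisation,
oscillating faster on longer shapes. [folklore] -/
noncomputable def shapeTerm (κ : ℝ) : ℕ → (ℕ → ℝ) → Unit → ℕ → ℝ :=
  fun _ g _ n => Real.exp (-(κ * n)) * Real.sin ((n + 1) * g 0)

/-- The witness satisfies the bound (B) with `B = 1` and the PER-SHAPE moduli of `sepUC_of_shapes` at the weight `κ` (shape `n`: `δ = ε∕(n+1)`),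
on any coupling box. [folklore] -/
theorem shapeTerm_hyps (κ : ℝ) (I : Set ℝ) :
    (∀ (k : ℕ) (U : shapeTower.B) (X : shapeTower.Dom), ∀ g ∈ BoxWindow I,
        Real.exp (κ * shapeTower.d X) * |shapeTerm κ k g U X| ≤ 1) ∧
      ∀ (σ : ℕ) (m i : ℕ), i < m → ∀ ε : ℝ, 0 < ε → ∃ δ : ℝ, 0 < δ ∧
        ∀ (k : ℕ) (U : shapeTower.B) (X : shapeTower.Dom), X = σ → shapeTower.r X + m = k →
          ∀ g ∈ BoxWindow I, ∀ g' ∈ BoxWindow I, (∀ j, j ≠ i → g j = g' j) → |g i - g' i| ≤ δ →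
            Real.exp (κ * shapeTower.d X) * |shapeTerm κ k g U X - shapeTerm κ k g' U X| ≤ ε := by
  have hnorm : ∀ (k : ℕ) (U : Unit) (n : ℕ) (g : ℕ → ℝ),
      Real.exp (κ * (n : ℝ)) * shapeTerm κ k g U n = Real.sin ((n + 1) * g 0) := by
    intro k U n g
    simp only [shapeTerm]
    rw [← mul_assoc, ← Real.exp_add, add_neg_cancel, Real.exp_zero, one_mul]
  refine ⟨fun k U (n : ℕ) g _ => ?_, fun σ m i _ ε hε => ?_⟩
  · show Real.exp (κ * (n : ℝ)) * |shapeTerm κ k g U n| ≤ 1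
    rw [← abs_of_pos (Real.exp_pos (κ * (n : ℝ))), ← abs_mul, hnorm]
    exact Real.abs_sin_le_one _
  · refine ⟨ε / (σ + 1), by positivity, fun k U (n : ℕ) hn _ g _ g' _ hagree hdiff => ?_⟩
    show Real.exp (κ * (n : ℝ)) * |shapeTerm κ k g U n - shapeTerm κ k g' U n| ≤ ε
    rw [← abs_of_pos (Real.exp_pos (κ * (n : ℝ))), ← abs_mul, mul_sub, hnorm, hnorm]
    subst hn
    by_cases hi : i = 0
    · subst hi
      have hσ : (0 : ℝ) < n + 1 := by positivity
      calc |Real.sin ((n + 1) * g 0) - Real.sin ((n + 1) * g' 0)| ≤ |(n + 1) * g 0 - (n + 1) * g' 0| :=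
            Real.abs_sin_sub_sin_le _ _
        _ = (n + 1) * |g 0 - g' 0| := by rw [← mul_sub, abs_mul, abs_of_pos hσ]
        _ ≤ (n + 1) * (ε / (n + 1)) := mul_le_mul_of_nonneg_left hdiff hσ.le
        _ = ε := by field_simp
    · rw [hagree 0 (Ne.symm hi), sub_self, abs_zero]
      exact hε.le

/-- **NO MODULUS SERVES ALL SHAPES AT THE WEIGHT `κ`**: on the box `BoxWindow univ` the carriers-level hypothesis `hUC` of `TowerCarriersKing` FAILS
for the witness at scale `1`, coordinate `0` (shape `n` with `π∕(n+1) ≤ δ`, `g₀ = π∕(2(n+1))` against `g₀ + π∕(n+1)`: normalised difference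
`|sin(π∕2) − sin(3π∕2)| = 2`), although by `shapeTerm_hyps` + `sepUC_of_shapes` it HOLDS at every `κ' < κ`.  So the κ-loss of §2 cannot be
dropped with continuity + the bound alone. [folklore] -/
theorem shapeTerm_not_sepUC_at_kappa (κ : ℝ) :
    ¬ (∀ m i : ℕ, i < m → ∀ ε : ℝ, 0 < ε → ∃ δ : ℝ, 0 < δ ∧
        ∀ (k : ℕ) (U : shapeTower.B) (X : shapeTower.Dom), shapeTower.r X + m = k →
          ∀ g ∈ BoxWindow (Set.univ : Set ℝ), ∀ g' ∈ BoxWindow (Set.univ : Set ℝ), (∀ j, j ≠ i → g j = g' j) → |g i - g' i| ≤ δ →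
            Real.exp (κ * shapeTower.d X) * |shapeTerm κ k g U X - shapeTerm κ k g' U X| ≤ 1) := by
  intro h
  obtain ⟨δ, hδ, hδ'⟩ := h 1 0 Nat.zero_lt_one 1 one_pos
  obtain ⟨n, hn⟩ := exists_nat_ge (Real.pi / δ)
  have hπ : 0 < Real.pi := Real.pi_pos
  have hn1 : (0 : ℝ) < n + 1 := by positivity
  have hstep : Real.pi / (n + 1) ≤ δ := by
    rw [div_le_iff₀ hn1]
    have h1 : Real.pi / δ * δ = Real.pi := div_mul_cancel₀ _ hδ.ne'
    nlinarith [mul_le_mul_of_nonneg_right hn hδ.le]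
  set g : ℕ → ℝ := fun j => if j = 0 then Real.pi / (2 * (n + 1)) else 0 with hg
  set g' : ℕ → ℝ := fun j => if j = 0 then Real.pi / (2 * (n + 1)) + Real.pi / (n + 1) else 0 with hg'
  have hmem : ∀ f : ℕ → ℝ, f ∈ BoxWindow (Set.univ : Set ℝ) := fun f j => Set.mem_univ _
  have key := hδ' 1 () n (by rfl) g (hmem g) g' (hmem g') (fun j hj => by simp [hg, hg', hj])
    (by
      simp only [hg, hg', if_true]
      rw [show Real.pi / (2 * (n + 1)) - (Real.pi / (2 * (n + 1)) + Real.pi / (n + 1)) = -(Real.pi / (n + 1)) by ring,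
        abs_neg, abs_of_nonneg (by positivity)]
      exact hstep)
  have hnorm : ∀ f : ℕ → ℝ, Real.exp (κ * (n : ℝ)) * shapeTerm κ 1 f () n = Real.sin ((n + 1) * f 0) := by
    intro f
    simp only [shapeTerm]
    rw [← mul_assoc, ← Real.exp_add, add_neg_cancel, Real.exp_zero, one_mul]
  have e : Real.exp (κ * shapeTower.d n) * |shapeTerm κ 1 g () n - shapeTerm κ 1 g' () n| =
      |Real.sin ((n + 1) * g 0) - Real.sin ((n + 1) * g' 0)| := by
    show Real.exp (κ * (n : ℝ)) * |shapeTerm κ 1 g () n - shapeTerm κ 1 g' () n| = _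
    rw [← abs_of_pos (Real.exp_pos (κ * (n : ℝ))), ← abs_mul, mul_sub, hnorm, hnorm]
  rw [e] at key
  have s1 : Real.sin ((n + 1) * g 0) = 1 := by
    simp only [hg, if_true]
    rw [show ((n : ℝ) + 1) * (Real.pi / (2 * (n + 1))) = Real.pi / 2 by field_simp, Real.sin_pi_div_two]
  have s2 : Real.sin ((n + 1) * g' 0) = -1 := by
    simp only [hg', if_true]
    rw [show ((n : ℝ) + 1) * (Real.pi / (2 * (n + 1)) + Real.pi / (n + 1)) = Real.pi / 2 + Real.pi by field_simp,
      Real.sin_add_pi, Real.sin_pi_div_two]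
  rw [s1, s2] at key
  norm_num at key

end Summit.QuantumFields.BalabanUV.T4Continuum.NE9.DirectPairingLocality
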